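import Literature.Analysis.Complex.PQFrame
import Literature.Analysis.Complex.DbarPoincarePolydiscFrame
import HarnessLib

/-!
# The `∂̄`-Poincaré lemma for `(p,q+1)`-forms on polydiscs of `ℂ^ι` (Hörmander, Theorem 2.3.3)

Flat, all-bidegree form of the Dolbeault–Grothendieck lemma: let `D = D(c, r) ⊆ ℂ^ι` be an open
polydisc, `α : ℂ^ι → Λ^{p+q+1}` a form which is `C^∞` on `D`, of pointwise type `(p,q+1)` on `D`,
and `∂̄`-closed on `D`, i.e. `(dα)^{p,q+2} = 0` there (for forms of pure type, `∂̄α = (dα)^{p,q+2}`,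
the tree's `IsOfType.dolbeaultBar_eq`). Then for all radii `r' < r` there is a `C^∞` form
`β : ℂ^ι → Λ^{p+q}` of type `(p,q)` with `(dβ)^{p,q+1} = α` on `D(c, r')`
(`Literature.Analysis.Complex.exists_dbar_potential_of_type`), i.e. `∂̄β = α` on `D(c,r')` for
the tree's Dolbeault operator on the flat complex manifold `ℂ^ι`
(`dolbeaultBar_potential_eq`).

This is Hörmander's Theorem 2.3.3 for all `p, q ≥ 0`; it is obtained from the abstract version in
a `DbarFrame` (`Literature/Analysis/Complex/DbarPoincarePolydiscFrame.lean`) applied to the frames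
of `(p,·)`-forms `pqFrame`/`pqFrameZero` (`Literature/Analysis/Complex/PQFrame.lean`), the frame
`∂̄` being the coordinate `∂̄ = ∑_j dz̄_j ∧ ∂/∂z̄_j` which is `(d ·)^{p,q+1}` on forms of type
`(p,q)` (`Literature/Analysis/Complex/PQExtDeriv.lean`).

## References

* L. Hörmander, *An Introduction to Complex Analysis in Several Variables*, 2nd ed. (1973),
  Thm. 2.3.3. [HormanderSCV1973]
* C. Voisin, *Hodge Theory and Complex Algebraic Geometry I* (2002), Prop. 2.36. [Voisin2002]
-/

noncomputable section

open scoped Manifold ComplexConjugate ContDiff Topology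
open Complex Function ContinuousAlternatingMap Set Filter
open Literature.LinearAlgebra.Alternating Literature.Geometry.Kaehler Literature.NumberTheory.Transcendental

namespace Literature.Analysis.Complex

variable {ι : Type*} [Fintype ι] [DecidableEq ι]

/-! ### Assembly from a frame on the type levels -/

omit [DecidableEq ι] in
/-- The exterior derivative is local. [folklore] -/
theorem extDeriv_congr_of_eventuallyEq {k : ℕ} {α α' : (ι → ℂ) → (ι → ℂ) [⋀^Fin k]→L[ℝ] ℂ}
    {z : ι → ℂ} (h : α' =ᶠ[𝓝 z] α) : extDeriv α' z = extDeriv α z := by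
  rw [extDeriv, extDeriv, h.fderiv_eq]

/-- The type projection `η ↦ η^{p,q}` as a real continuous linear map INTO the subspace
`Λ^{p,q}` (used to feed data of pure type to the frames). [folklore] -/
def projT (k p q : ℕ) : ((ι → ℂ) [⋀^Fin k]→L[ℝ] ℂ) →L[ℝ] ↥(typeSubmodule (ι → ℂ) k p q) where
  toFun η := ⟨typeProjAt p q η, typeProjAt_typeProjAt_self p q η⟩
  map_add' η η' := Subtype.ext (typeProjAt_add p q η η')
  map_smul' a η := Subtype.ext (by
    change typeProjAt p q (a • η) = a • typeProjAt p q η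
    have h1 : a • η = (a : ℂ) • η := by ext v; simp
    have h2 : ∀ ζ : (ι → ℂ) [⋀^Fin k]→L[ℝ] ℂ, a • ζ = (a : ℂ) • ζ := fun ζ => by ext v; simp
    rw [h1, h2, typeProjAt_smul])
  cont := (continuous_typeProjAt p q).subtype_mk _

omit [DecidableEq ι] in
/-- Values of `projT`. [folklore] -/
@[simp]
theorem coe_projT (k p q : ℕ) (η : (ι → ℂ) [⋀^Fin k]→L[ℝ] ℂ) :
    (projT k p q η : (ι → ℂ) [⋀^Fin k]→L[ℝ] ℂ) = typeProjAt p q η :=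
  rfl

omit [DecidableEq ι] in
/-- `projT` is smooth (a continuous linear map; stated with the instances of the subspace as a
normed space, as consumed by `DbarFrame.exists_dbar₁_eq_on_polydisc`). [folklore] -/
theorem contDiff_projT (k p q : ℕ) :
    ContDiff ℝ ∞ fun η : (ι → ℂ) [⋀^Fin k]→L[ℝ] ℂ => projT k p q η :=
  ContinuousLinearMap.contDiff (𝕜 := ℝ) (E := (ι → ℂ) [⋀^Fin k]→L[ℝ] ℂ)
    (F := ↥(typeSubmodule (ι → ℂ) k p q)) (projT k p q)

omit [DecidableEq ι] in
/-- The inclusion `Λ^{p,q} ⊆ Λ^k` is smooth. [folklore] -/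
theorem contDiff_coe_typeSubmodule (k p q : ℕ) :
    ContDiff ℝ ∞ fun y : ↥(typeSubmodule (ι → ℂ) k p q) => (y : (ι → ℂ) [⋀^Fin k]→L[ℝ] ℂ) :=
  ContinuousLinearMap.contDiff (𝕜 := ℝ) (E := ↥(typeSubmodule (ι → ℂ) k p q))
    (F := (ι → ℂ) [⋀^Fin k]→L[ℝ] ℂ) ((typeSubmodule (ι → ℂ) k p q).subtypeL.restrictScalars ℝ)

/-- In a frame on the type levels whose creation operators are `dz̄_j ∧ ·`, each term of the frame
`∂̄` is a term of the coordinate `∂̄`: `dz̄_j ∧ ∂̄_j u` after forgetting the type.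
[cite: HormanderSCV1973, §2.1] -/
theorem coe_ε₁_dbarAlong {n p q : ℕ} {Λ₀ Λ₃ : Type*} [NormedAddCommGroup Λ₀] [NormedSpace ℂ Λ₀]
    [NormedAddCommGroup Λ₃] [NormedSpace ℂ Λ₃]
    (𝔉 : DbarFrame ι Λ₀ (TypeSpace ι n p q) (TypeSpace ι (n + 1) p (q + 1)) Λ₃)
    (hε₁ : ∀ (j : ι) (y : TypeSpace ι n p q),
      ((𝔉.ε₁ j y : TypeSpace ι (n + 1) p (q + 1)) : (ι → ℂ) [⋀^Fin (n + 1)]→L[ℝ] ℂ) =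
        wedgeOne (dzBar j) (y : (ι → ℂ) [⋀^Fin n]→L[ℝ] ℂ))
    {u : (ι → ℂ) → TypeSpace ι n p q} {z : ι → ℂ} (hu : ContDiffAt ℝ 1 u z) (j : ι) :
    ((𝔉.ε₁ j (dbarAlong (Pi.single j 1) u z) : TypeSpace ι (n + 1) p (q + 1)) :
        (ι → ℂ) [⋀^Fin (n + 1)]→L[ℝ] ℂ) =
      wedgeOne (dzBar j) (dbarAlong (Pi.single j 1) (fun y => (u y : (ι → ℂ) [⋀^Fin n]→L[ℝ] ℂ)) z) := by
  rw [hε₁]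
  congr 1
  exact (dbarAlong_clm_comp (F := TypeSpace ι n p q) (typeSubmodule (ι → ℂ) n p q).subtypeL
    (hu.differentiableAt one_ne_zero) _).symm

/-- In a frame on the type levels whose creation operators are `dz̄_j ∧ ·`, the frame `∂̄` is the
coordinate `∂̄` after forgetting the type: `𝔉.dbar₁ u (z) = ∑_j dz̄_j ∧ ∂̄_j u (z)`.
[cite: HormanderSCV1973, §2.1] -/
theorem coe_dbar₁_eq_sum {n p q : ℕ} {Λ₀ Λ₃ : Type*} [NormedAddCommGroup Λ₀] [NormedSpace ℂ Λ₀]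
    [NormedAddCommGroup Λ₃] [NormedSpace ℂ Λ₃]
    (𝔉 : DbarFrame ι Λ₀ (TypeSpace ι n p q) (TypeSpace ι (n + 1) p (q + 1)) Λ₃)
    (hε₁ : ∀ (j : ι) (y : TypeSpace ι n p q),
      ((𝔉.ε₁ j y : TypeSpace ι (n + 1) p (q + 1)) : (ι → ℂ) [⋀^Fin (n + 1)]→L[ℝ] ℂ) =
        wedgeOne (dzBar j) (y : (ι → ℂ) [⋀^Fin n]→L[ℝ] ℂ))
    {u : (ι → ℂ) → TypeSpace ι n p q} {z : ι → ℂ} (hu : ContDiffAt ℝ 1 u z) :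
    ((𝔉.dbar₁ u z : TypeSpace ι (n + 1) p (q + 1)) : (ι → ℂ) [⋀^Fin (n + 1)]→L[ℝ] ℂ) =
      ∑ j, wedgeOne (dzBar j) (dbarAlong (Pi.single j 1) (fun y => (u y : (ι → ℂ) [⋀^Fin n]→L[ℝ] ℂ)) z) := by
  rw [DbarFrame.dbar₁_apply, Submodule.coe_sum]
  exact Finset.sum_congr rfl fun j _ => coe_ε₁_dbarAlong 𝔉 hε₁ hu j

/-- **Assembly step**: the `∂̄`-Poincaré lemma for data of type `(p,q+1)` from ANY `∂̄`-frame on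
the levels `Λ₀, Λ^{p,q}_n, Λ^{p,q+1}_{n+1}, Λ^{p,q+2}_{n+2}` whose creation operators are `dz̄_j ∧ ·`
(the two frames `pqFrameZero`, `pqFrame` of `PQFrame.lean`). [cite: HormanderSCV1973, Thm. 2.3.3] -/
theorem exists_dbar_potential_of_frame {n p q : ℕ} {Λ₀ : Type*} [NormedAddCommGroup Λ₀]
    [NormedSpace ℂ Λ₀] [CompleteSpace Λ₀]
    (𝔉 : DbarFrame ι Λ₀ (TypeSpace ι n p q) (TypeSpace ι (n + 1) p (q + 1)) (TypeSpace ι (n + 2) p (q + 2)))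
    (hε₁ : ∀ (j : ι) (y : TypeSpace ι n p q),
      ((𝔉.ε₁ j y : TypeSpace ι (n + 1) p (q + 1)) : (ι → ℂ) [⋀^Fin (n + 1)]→L[ℝ] ℂ) =
        wedgeOne (dzBar j) (y : (ι → ℂ) [⋀^Fin n]→L[ℝ] ℂ))
    (hε₂ : ∀ (j : ι) (y : TypeSpace ι (n + 1) p (q + 1)),
      ((𝔉.ε₂ j y : TypeSpace ι (n + 2) p (q + 2)) : (ι → ℂ) [⋀^Fin (n + 2)]→L[ℝ] ℂ) =
        wedgeOne (dzBar j) (y : (ι → ℂ) [⋀^Fin (n + 1)]→L[ℝ] ℂ))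
    {c : ι → ℂ} {r r' : ι → ℝ} (hr : ∀ i, r' i < r i)
    {α : (ι → ℂ) → (ι → ℂ) [⋀^Fin (n + 1)]→L[ℝ] ℂ} (hα : ContDiffOn ℝ ∞ α (polydisc c r))
    (htype : ∀ x ∈ polydisc c r, IsOfTypeAt p (q + 1) (α x))
    (hclosed : ∀ x ∈ polydisc c r, typeProjAt p (q + 2) (extDeriv α x) = 0) :
    ∃ β : (ι → ℂ) → (ι → ℂ) [⋀^Fin n]→L[ℝ] ℂ, ContDiff ℝ ∞ β ∧
      (∀ x, typeProjAt p q (β x) = β x) ∧ ∀ x ∈ polydisc c r', typeProjAt p (q + 1) (extDeriv β x) = α x := by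
  have hD : IsOpen (polydisc c r) := isOpen_polydisc c r
  -- the projected data `f : ℂ^ι → Λ^{p,q+1}_{n+1}`, equal to `α` on `D`
  let f : (ι → ℂ) → TypeSpace ι (n + 1) p (q + 1) := fun x => projT (n + 1) p (q + 1) (α x)
  have hfα : ∀ x ∈ polydisc c r, (f x : (ι → ℂ) [⋀^Fin (n + 1)]→L[ℝ] ℂ) = α x :=
    fun x hx => (htype x hx).typeProjAt_eq_self
  have hf : ContDiffOn ℝ ∞ f (polydisc c r) := (contDiff_projT (n + 1) p (q + 1)).comp_contDiffOn hα
  -- `∂̄ f = 0` on `D`: the type of `α` on `D` gives `p + q = n`, so the projections are honest types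
  have hcl : ∀ z ∈ polydisc c r, 𝔉.dbar₂ f z = 0 := by
    intro z hz
    have hn : p + (q + 1) = n + 1 := (htype z hz).1
    have hα' : ∀ y, IsOfTypeAt p (q + 1) (typeProjAt p (q + 1) (α y)) := fun y =>
      isOfTypeAt_typeProjAt hn (α y)
    apply Subtype.ext
    rw [DbarFrame.dbar₂_apply, Submodule.coe_sum, ZeroMemClass.coe_zero]
    calc ∑ j, ((𝔉.ε₂ j (dbarAlong (Pi.single j 1) f z) : TypeSpace ι (n + 2) p (q + 2)) :
            (ι → ℂ) [⋀^Fin (n + 2)]→L[ℝ] ℂ)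
        = ∑ j, wedgeOne (dzBar j)
            (dbarAlong (Pi.single j 1) (fun y => typeProjAt p (q + 1) (α y)) z) := by
          refine Finset.sum_congr rfl fun j _ => ?_
          rw [hε₂]
          congr 1
          exact (dbarAlong_clm_comp (F := TypeSpace ι (n + 1) p (q + 1))
            (typeSubmodule (ι → ℂ) (n + 1) p (q + 1)).subtypeL
            ((hf.contDiffAt (hD.mem_nhds hz)).differentiableAt (by simp)) _).symm
      _ = typeProjAt p (q + 2) (extDeriv (fun y => typeProjAt p (q + 1) (α y)) z) :=
          (typeProjAt_extDeriv_eq_sum hα' z).symm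
      _ = typeProjAt p (q + 2) (extDeriv α z) := by
          rw [extDeriv_congr_of_eventuallyEq]
          filter_upwards [hD.mem_nhds hz] with y hy
          exact (htype y hy).typeProjAt_eq_self
      _ = 0 := hclosed z hz
  -- solve in the frame
  obtain ⟨u, hu, huf⟩ := 𝔉.exists_dbar₁_eq_on_polydisc hr hf hcl
  refine ⟨fun x => (u x : (ι → ℂ) [⋀^Fin n]→L[ℝ] ℂ), (contDiff_coe_typeSubmodule n p q).comp hu,
    fun x => typeProjAt_coe (u x), fun x hx => ?_⟩
  have hxD : x ∈ polydisc c r := polydisc_mono c (fun i => (hr i).le) hx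
  have hn : p + q = n := by have := (htype x hxD).1; omega
  have hβt : ∀ y, IsOfTypeAt p q ((u y : (ι → ℂ) [⋀^Fin n]→L[ℝ] ℂ)) := fun y => isOfTypeAt_coe hn (u y)
  rw [typeProjAt_extDeriv_eq_sum hβt, ← hfα x hxD]
  have e2 : ((f x : TypeSpace ι (n + 1) p (q + 1)) : (ι → ℂ) [⋀^Fin (n + 1)]→L[ℝ] ℂ) =
      ((𝔉.dbar₁ u x : TypeSpace ι (n + 1) p (q + 1)) : (ι → ℂ) [⋀^Fin (n + 1)]→L[ℝ] ℂ) := by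
    rw [huf x hx]
  have hu1 : ContDiffAt ℝ 1 u x := hu.contDiffAt.of_le (by exact_mod_cast le_top)
  have e3 := coe_dbar₁_eq_sum 𝔉 hε₁ (u := u) (z := x) hu1
  exact (e2.trans e3).symm

/-! ### The theorem -/

/-- The zero space `Λ^{p,-1} = ⊥` is complete. [folklore] -/
instance completeSpace_bot (n : ℕ) :
    CompleteSpace (⊥ : Submodule ℂ ((ι → ℂ) [⋀^Fin n]→L[ℝ] ℂ)) := by
  have : IsClosed (((⊥ : Submodule ℂ ((ι → ℂ) [⋀^Fin n]→L[ℝ] ℂ)) :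
      Set ((ι → ℂ) [⋀^Fin n]→L[ℝ] ℂ))) := by
    rw [Submodule.bot_coe]
    exact isClosed_singleton
  exact this.completeSpace_coe

/-- **The `∂̄`-Poincaré lemma on polydiscs for forms of type `(p,q+1)`** (Hörmander (1973),
Thm. 2.3.3; Dolbeault–Grothendieck lemma, Voisin (2002), Prop. 2.36): let `D = D(c,r) ⊆ ℂ^ι` be an
open polydisc and `α : ℂ^ι → Λ^{n+1}` a form, `C^∞` on `D`, of pointwise type `(p,q+1)` on `D` (so
`n = p + q` when `D ≠ ∅`) and with `(dα)^{p,q+2} = 0` on `D` (`∂̄α = 0`). Then for all radii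
`r' < r` there is `β ∈ C^∞(ℂ^ι, Λ^n)`, fixed by the `(p,q)`-projection (of type `(p,q)`), with
`(dβ)^{p,q+1} = α` (`∂̄β = α`) on `D(c, r')`. [cite: HormanderSCV1973, Thm. 2.3.3] -/
theorem exists_dbar_potential_of_type {n p q : ℕ} {c : ι → ℂ} {r r' : ι → ℝ} (hr : ∀ i, r' i < r i)
    {α : (ι → ℂ) → (ι → ℂ) [⋀^Fin (n + 1)]→L[ℝ] ℂ} (hα : ContDiffOn ℝ ∞ α (polydisc c r))
    (htype : ∀ x ∈ polydisc c r, IsOfTypeAt p (q + 1) (α x))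
    (hclosed : ∀ x ∈ polydisc c r, typeProjAt p (q + 2) (extDeriv α x) = 0) :
    ∃ β : (ι → ℂ) → (ι → ℂ) [⋀^Fin n]→L[ℝ] ℂ, ContDiff ℝ ∞ β ∧
      (∀ x, typeProjAt p q (β x) = β x) ∧ ∀ x ∈ polydisc c r', typeProjAt p (q + 1) (extDeriv β x) = α x := by
  cases q with
  | zero =>
    exact exists_dbar_potential_of_frame (pqFrameZero ι n p) (fun j y => rfl) (fun j y => rfl) hr hα
      htype hclosed
  | succ q' =>
    cases n with
    | zero =>
      -- no nonzero forms of type `(p, q'+2)` in degree `1`: `α = 0` on `D`, take `β = 0`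
      refine ⟨0, contDiff_const, fun x => by simp, fun x hx => ?_⟩
      have hxD : x ∈ polydisc c r := polydisc_mono c (fun i => (hr i).le) hx
      have := (htype x hxD).1
      omega
    | succ n' =>
      exact exists_dbar_potential_of_frame (pqFrame ι n' p q') (fun j y => rfl) (fun j y => rfl) hr hα
        htype hclosed

/-- **`∂̄β = α` for the tree's Dolbeault operator.** In the situation of
`exists_dbar_potential_of_type` with `n = p + q`, the potential `β` satisfies `∂̄β (x) = α (x)` on
`D(c, r')` for `Literature.NumberTheory.Transcendental.dolbeaultBar` on the flat complex manifold
`ℂ^ι` (via `dolbeaultBar_apply_eq_sum`). [cite: HormanderSCV1973, Thm. 2.3.3] -/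
theorem exists_dolbeaultBar_eq_of_type {p q : ℕ} {c : ι → ℂ} {r r' : ι → ℝ} (hr : ∀ i, r' i < r i)
    {α : (ι → ℂ) → (ι → ℂ) [⋀^Fin (p + q + 1)]→L[ℝ] ℂ} (hα : ContDiffOn ℝ ∞ α (polydisc c r))
    (htype : ∀ x ∈ polydisc c r, IsOfTypeAt p (q + 1) (α x))
    (hclosed : ∀ x ∈ polydisc c r, typeProjAt p (q + 2) (extDeriv α x) = 0) :
    ∃ β : (ι → ℂ) → (ι → ℂ) [⋀^Fin (p + q)]→L[ℝ] ℂ, ContDiff ℝ ∞ β ∧ (∀ x, IsOfTypeAt p q (β x)) ∧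
      ∀ x ∈ polydisc c r',
        dolbeaultBar (show MForm 𝓘(ℝ, ι → ℂ) (ι → ℂ) ℂ (p + q) from β) x = α x := by
  obtain ⟨β, hβ, hβp, hβα⟩ := exists_dbar_potential_of_type hr hα htype hclosed
  have hβt : ∀ x, IsOfTypeAt p q (β x) := fun x =>
    (isOfTypeAt_iff_typeProjAt_eq_self rfl (β x)).2 (hβp x)
  refine ⟨β, hβ, hβt, fun x hx => ?_⟩
  rw [dolbeaultBar_apply_eq_sum hβt, ← typeProjAt_extDeriv_eq_sum hβt, hβα x hx]

end Literature.Analysis.Complex
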